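/-
Copyright: the b2b-balaban T⁴-continuum CRUX team, row NE7b leaf lineage `t4-ne7b-formalise-leaf-03` (gen 155; v1.1 = v1 + chair G-1). Project licence.
-/
import Summits.QuantumFields.BalabanUV.T4Continuum.Spine.NE7b.AugmentedInversePeriodic
import Literature.MathematicalPhysics.QuantumFieldTheory.Balaban1983to89.Beta.VolumeImages

/-!
# THE PERIODIC SUBSPACE OF `ℓ^∞(ℤ^d)` IS THE TORUS SUP CARRIER: `s`-periodic bounded fields on `ℤ^d` and functions on the torus
# `(ℤ∕s)^d = Beta.Site d s` (Mathlib's Pi sup norm) are ISOMETRIC through `Beta.siteOf` ∕ `Beta.windowMap` — periodisation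
# `E g = g ∘ siteOf` (`‖E g‖_∞ = ‖g‖_∞`) and restriction to window representatives `R h = h ∘ windowMap` (`‖R‖ ≤ 1`, `R ∘ E = 1`,
# `E ∘ R = 1` and `‖R h‖ = ‖h‖` on periodic `h`) — so ANY chart of `ℓ^∞` that maps periodic data to periodic data ((72)
# `…AugmentedInversePeriodic`) IS a bijection between torus carriers with the SAME constant: the `Fintype`-carrier bridge (72) ∕ (73)
# name as not typed (row NE7b, node U5c; `Beta.siteOf` kit + (72) BY NAME; [folklore])

Cell `pub-balaban`, sub-cell `t4`, spine estimate NE7b (`T4WeightBudget.RelWeightBound`; the cell's OWN estimate — NOT PRINTED in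
[Bałaban 1983–89], NOT PROVED).  Crux-route work under `Spine/NE7b/` by a row leaf (`t4-ne7b-formalise-leaf-03` gen 155) under
FREEZE (0)'s crux-prover clause; NOTHING of Bałaban's is named as a Lean object, valued or asserted; no `T4Continuum/Support` leaf
typed; no `def`, no notation (the two carrier maps are delivered as `∃ E R, …` with their pointwise actions DISPLAYED, and every law
is stated FOR ANY maps with those actions); zero `sorry`.  Imports (BY NAME): the OWNER's (72) `…AugmentedInversePeriodic`
(`exists_aug_equiv_sup_periodic` — used only in §4) and the Literature torus ↔ window dictionary `…Beta.VolumeImages` (through it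
`…Beta.InfiniteVolume`: `Beta.Site`, `Beta.siteOf`, `Beta.windowMap`, `Beta.siteOf_windowMap`, `Beta.imageShift`,
`Beta.siteOf_imageShift`, `Beta.exists_eq_imageShift_of_siteOf_eq`).

WHY (located).  (72) proves that ASE's chart `T h = (Q′h, P(Ah))`, `T : ℓ^∞ ≃L ℓ^∞ × ker Q′`, maps `side·s`-periodic fine fields to
(`s`-periodic, `side·s`-periodic) pairs and back «so the chart … hold[s] verbatim on the torus by restriction», with the HONEST line
«no `Fintype` carrier …; the bridge `periodic fields ≃ torus fields` is the Literature `Beta.siteOf` kit's business and is not typed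
here» ((73) idem; PRICING-NE7b v134 §3 «no `LinfT` carrier bridge yet»).  THIS FILE types that bridge for every period `s ≥ 1` and
every `d`, in the sup currency of `…HardStepRadiusSupNorm` (functions on a `Fintype`, Pi norm), and runs the transfer (§3 abstract:
«periodic-to-periodic chart of `ℓ^∞` ⟹ torus chart, same constant»; §4 its instance on (72)).

WHAT IS PROVED ([folklore]; `ℓ^∞ := lp (fun _ : X d => ℝ) ∞`; `s : ℕ`, `[NeZero s]`; «`h` is `s`-periodic» := `∀ q t, h (q + s•t) = h q`):
* §1 `imageShift_eq_add_smul`, `siteOf_add_smul`, `exists_windowMap_siteOf` (`windowMap (siteOf q) = q + s•m`), **`apply_windowMap_siteOf`**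
  (periodic `h`: `h (windowMap (siteOf q)) = h q`), **`periodic_iff_exists_comp_siteOf`** (`h` periodic ↔ `h = g ∘ siteOf`),
  `abs_comp_siteOf_le_norm`, `memℓp_comp_siteOf`.
* §2 **`exists_clm_periodise`** (`E : (Site d s → ℝ) →L[ℝ] ℓ^∞`, `E g q = g (siteOf q)`), **`exists_clm_restrict`** (`R : ℓ^∞ →L[ℝ]
  (Site d s → ℝ)`, `R h x = h (windowMap x)`, `‖R‖ ≤ 1`); FOR ANY maps with these actions: `periodise_periodic`, **`norm_periodise`**
  (`‖E g‖ = ‖g‖`), **`restrict_periodise`** (`R (E g) = g`), **`periodise_restrict_of_periodic`** (`E (R h) = h`),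
  **`norm_restrict_of_periodic`**, `periodise_injective`, `eq_of_restrict_eq_of_periodic`; assembled **`exists_torus_carrier`**.
* §3 FOR ANY `Dop : ℓ^∞ →L ℓ^∞`, `Rop : ℓ^∞ →L Dop.ker`, periods `N` (fine) ∕ `s` (coarse), carrier maps `Ef ∕ Rf`, `Ec ∕ Rc`:
  **`torus_coords_of_periodic`** (FORWARD: if `Dop ∕ Rop` send `N`-periodic fields to `s`- ∕ `N`-periodic ones, every torus field
  `ht` has torus chart coordinates `(Rc (Dop (Ef ht)), Rf (Rop (Ef ht)))`, the second in the fibre) and **`torus_chart_of_periodic`**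
  (INVERSE: if `T h = (Dop h, Rop h)` is an equivalence `ℓ^∞ ≃L ℓ^∞ × Dop.ker` with `‖T⁻¹ y‖ ≤ C‖y‖` and `T⁻¹` of periodic data is
  `N`-periodic, then for every torus datum `(wt, κt)` with `Dop (Ef κt) = 0` there is EXACTLY ONE torus field `ht` with
  `Dop (Ef ht) = Ec wt`, `Rop (Ef ht) = Ef κt`, and `‖ht‖ ≤ C·max ‖wt‖ ‖κt‖`) — a bijection of torus carriers, same constant.
* §4 `natCast_mul_smul_eq`, **`exists_aug_chart_torus`** (`d ≥ 3`, every side, `a > 0`, period `s`): (72)'s chart RE-EXPORTED (actions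
  `Q′ ∕ A ∕ P`, `Rop = P∘A`, `T`, displayed `T⁻¹`, `N_∞`) with the four carrier maps and BOTH conclusions of §3 on the tori
  `Site d ((n+1)·s)` ∕ `Site d s`, constant `N_∞ = C_∞ + A_G·K_d(δ_u∕4)·(1 + C_∞)`.  §5 toy at `s = 1`.

HONEST (what this is NOT).  Carrier bookkeeping only: no estimate improved, the constant is (72)'s (existential; useless by value at small
sides — `…OneShotChartTorusCertificateSideTwo ∕ …SideThree`; the mixed currency of record untouched); cubic periods only (rectangular
`B5Prop11Plancherel.Tor` carriers not treated); torus-side operators DISPLAYED through window representatives, not re-built from a torus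
block structure; scalar skeleton, not the covariant operators ((A3), NC-NE7b-α UNRULED); nothing of Bałaban's.  BY-NAME EFFECT ON THE
WALL: NONE.  NE7b NOT PRINTED ∕ NOT PROVED; spine PROVED 0∕9; rung (B)+1 on a FINITE torus — NOT infinite volume, NOT the mass gap, NOT
Clay.  HONEST DEPENDENCY: continuum YM on T⁴ ⇐ BetaPertH ∧ nine spine estimates (0∕9 proved); BetaPertH ⇐ (D1) ∧ (D4) ∧ CAP+tail;
G-an2-4 gates asym, D1 and NE2∕3∕4.
-/

set_option autoImplicit false

noncomputable section

namespace Summit.QuantumFields.BalabanUV.T4Continuum.NE7b.PeriodicSupTorusCarrier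

open scoped ENNReal
open Literature.MathematicalPhysics.QuantumFieldTheory.Balaban1983to89
open B4Sect5Proof (latticeConst)
open B6QGQLower276 (X blk B side AX)
open B6QGQDecay237 (deltaU)
open B5Hk103ScalarZd (Gk nbhd deltaH)
open B5Hk165L2Zd (HBZd)
open Summit.QuantumFields.BalabanUV.Beta.D1BFx.BlockColumnSupNorm (cHs)
open Summit.QuantumFields.BalabanUV.Beta.D1BFx.PointColumnSplit (cKL cG0 cSplit)
open Summit.QuantumFields.BalabanUV.Beta.D1BFx.PointColumnDecay (cFar)
open Beta (Site siteOf windowMap imageShift siteOf_windowMap siteOf_imageShift exists_eq_imageShift_of_siteOf_eq)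
open AugmentedInversePeriodic (exists_aug_equiv_sup_periodic)

variable {d : ℕ}

/-! ## §1. The pointwise dictionary: periodic fields are the fields `g ∘ siteOf` -/

/-- `imageShift s w m = w + s•m`. [folklore] -/
theorem imageShift_eq_add_smul (s : ℕ) (w m : X d) : imageShift s w m = w + (s : ℤ) • m := by
  funext i
  simp only [imageShift, Pi.add_apply, Pi.smul_apply, smul_eq_mul]

/-- Period translates have the same torus class: `siteOf (q + s•t) = siteOf q`. [folklore] -/
theorem siteOf_add_smul (s : ℕ) (q t : X d) : siteOf d s (q + (s : ℤ) • t) = siteOf d s q := by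
  rw [← imageShift_eq_add_smul]
  exact siteOf_imageShift q t

/-- The window representative of the class of `q` is a period translate of `q`. [folklore] -/
theorem exists_windowMap_siteOf (s : ℕ) [NeZero s] (q : X d) :
    ∃ m : X d, windowMap d s (siteOf d s q) = q + (s : ℤ) • m := by
  obtain ⟨m, hm⟩ := exists_eq_imageShift_of_siteOf_eq (s := s) (y := q) (x := siteOf d s q) rfl
  refine ⟨-m, ?_⟩
  rw [imageShift_eq_add_smul] at hm
  rw [smul_neg, ← sub_eq_add_neg, eq_sub_iff_add_eq]
  exact hm.symm

/-- **A periodic field is read off its window representatives**: `h (windowMap (siteOf q)) = h q`. [folklore] -/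
theorem apply_windowMap_siteOf {s : ℕ} [NeZero s] {h : X d → ℝ} (hh : ∀ q t : X d, h (q + (s : ℤ) • t) = h q)
    (q : X d) : h (windowMap d s (siteOf d s q)) = h q := by
  obtain ⟨m, hm⟩ := exists_windowMap_siteOf s q
  rw [hm, hh]

/-- **Periodic fields ARE torus fields**: `h` is `s`-periodic iff `h = g ∘ siteOf` for a (unique, §2) function `g` on the torus
`Site d s = (ℤ∕s)^d` — namely `g = h ∘ windowMap`. [folklore] -/
theorem periodic_iff_exists_comp_siteOf {s : ℕ} [NeZero s] (h : X d → ℝ) :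
    (∀ q t : X d, h (q + (s : ℤ) • t) = h q) ↔ ∃ g : Site d s → ℝ, ∀ q, h q = g (siteOf d s q) := by
  constructor
  · intro hh
    exact ⟨fun x => h (windowMap d s x), fun q => (apply_windowMap_siteOf hh q).symm⟩
  · rintro ⟨g, hg⟩ q t
    rw [hg, hg, siteOf_add_smul]

/-- The periodisation of a torus function is dominated by its sup norm. [folklore] -/
theorem abs_comp_siteOf_le_norm {s : ℕ} [NeZero s] (g : Site d s → ℝ) (q : X d) : |g (siteOf d s q)| ≤ ‖g‖ :=
  (Real.norm_eq_abs _).symm.trans_le (norm_le_pi_norm g _)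

/-- The periodisation of a torus function is in `ℓ^∞`. [folklore] -/
theorem memℓp_comp_siteOf {s : ℕ} [NeZero s] (g : Site d s → ℝ) : Memℓp (fun q : X d => g (siteOf d s q)) ∞ :=
  memℓp_infty ⟨‖g‖, by rintro _ ⟨q, rfl⟩; exact norm_le_pi_norm g _⟩

/-! ## §2. The two carrier maps `E` (periodisation) and `R` (restriction to the window) and their laws -/

/-- **PERIODISATION `E g = g ∘ siteOf` IS AN OPERATOR `(Site d s → ℝ) →L[ℝ] ℓ^∞(ℤ^d)`.** [folklore] -/
theorem exists_clm_periodise (s : ℕ) [NeZero s] :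
    ∃ E : (Site d s → ℝ) →L[ℝ] lp (fun _ : X d => ℝ) ∞,
      ∀ (g : Site d s → ℝ) (q : X d), E g q = g (siteOf d s q) := by
  let E₀ : (Site d s → ℝ) → lp (fun _ : X d => ℝ) ∞ := fun g => ⟨fun q => g (siteOf d s q), memℓp_comp_siteOf g⟩
  have hE₀ : ∀ (g : Site d s → ℝ) (q : X d), E₀ g q = g (siteOf d s q) := fun _ _ => rfl
  let El : (Site d s → ℝ) →ₗ[ℝ] lp (fun _ : X d => ℝ) ∞ :=
    { toFun := E₀
      map_add' := fun g g' => lp.ext (funext fun q => by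
        rw [lp.coeFn_add, Pi.add_apply, hE₀, hE₀, hE₀, Pi.add_apply])
      map_smul' := fun r g => lp.ext (funext fun q => by
        rw [lp.coeFn_smul, Pi.smul_apply, RingHom.id_apply, hE₀, hE₀, Pi.smul_apply]) }
  have hb : ∀ g, ‖El g‖ ≤ 1 * ‖g‖ := fun g => by
    rw [one_mul]
    exact lp.norm_le_of_forall_le (norm_nonneg g) fun q => by
      rw [Real.norm_eq_abs]
      exact abs_comp_siteOf_le_norm g q
  exact ⟨El.mkContinuous 1 hb, fun g q => rfl⟩

/-- **RESTRICTION TO THE WINDOW `R h = h ∘ windowMap` IS AN OPERATOR `ℓ^∞(ℤ^d) →L[ℝ] (Site d s → ℝ)` OF NORM `≤ 1`.** [folklore] -/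
theorem exists_clm_restrict (s : ℕ) [NeZero s] :
    ∃ R : lp (fun _ : X d => ℝ) ∞ →L[ℝ] (Site d s → ℝ),
      (∀ (h : lp (fun _ : X d => ℝ) ∞) (x : Site d s), R h x = h (windowMap d s x)) ∧ ‖R‖ ≤ 1 := by
  let Rl : lp (fun _ : X d => ℝ) ∞ →ₗ[ℝ] (Site d s → ℝ) :=
    { toFun := fun h x => h (windowMap d s x)
      map_add' := fun h h' => funext fun x => by
        rw [Pi.add_apply, lp.coeFn_add, Pi.add_apply]
      map_smul' := fun r h => funext fun x => by
        rw [Pi.smul_apply, RingHom.id_apply, lp.coeFn_smul, Pi.smul_apply] }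
  have hb : ∀ h, ‖Rl h‖ ≤ 1 * ‖h‖ := fun h => by
    rw [one_mul]
    exact (pi_norm_le_iff_of_nonneg (norm_nonneg h)).2 fun x => lp.norm_apply_le_norm ENNReal.top_ne_zero h _
  exact ⟨Rl.mkContinuous 1 hb, fun h x => rfl, Rl.mkContinuous_norm_le zero_le_one hb⟩

section Laws

variable {s : ℕ} [NeZero s] {E : (Site d s → ℝ) →L[ℝ] lp (fun _ : X d => ℝ) ∞}
  {R : lp (fun _ : X d => ℝ) ∞ →L[ℝ] (Site d s → ℝ)}

omit [NeZero s] in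
/-- A periodised torus function is `s`-periodic. [folklore] -/
theorem periodise_periodic (hE : ∀ (g : Site d s → ℝ) (q : X d), E g q = g (siteOf d s q)) (g : Site d s → ℝ)
    (q t : X d) : E g (q + (s : ℤ) • t) = E g q := by
  rw [hE, hE, siteOf_add_smul]

/-- **PERIODISATION IS AN ISOMETRY**: `‖E g‖_∞ = ‖g‖_∞` (every torus class is inhabited). [folklore] -/
theorem norm_periodise (hE : ∀ (g : Site d s → ℝ) (q : X d), E g q = g (siteOf d s q))
    (g : Site d s → ℝ) : ‖E g‖ = ‖g‖ := by
  apply le_antisymm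
  · exact lp.norm_le_of_forall_le (norm_nonneg g) fun q => by
      rw [Real.norm_eq_abs, hE]
      exact abs_comp_siteOf_le_norm g q
  · refine (pi_norm_le_iff_of_nonneg (norm_nonneg _)).2 fun x => ?_
    have h := lp.norm_apply_le_norm ENNReal.top_ne_zero (E g) (windowMap d s x)
    rwa [hE, siteOf_windowMap] at h

/-- **`R ∘ E = 1`**: restricting a periodised torus function to the window returns it. [folklore] -/
theorem restrict_periodise (hE : ∀ (g : Site d s → ℝ) (q : X d), E g q = g (siteOf d s q))
    (hR : ∀ (h : lp (fun _ : X d => ℝ) ∞) (x : Site d s), R h x = h (windowMap d s x)) (g : Site d s → ℝ) :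
    R (E g) = g := by
  funext x
  rw [hR, hE, siteOf_windowMap]

/-- **`E ∘ R = 1` ON PERIODIC FIELDS**: an `s`-periodic `h ∈ ℓ^∞` is the periodisation of its window restriction. [folklore] -/
theorem periodise_restrict_of_periodic (hE : ∀ (g : Site d s → ℝ) (q : X d), E g q = g (siteOf d s q))
    (hR : ∀ (h : lp (fun _ : X d => ℝ) ∞) (x : Site d s), R h x = h (windowMap d s x))
    {h : lp (fun _ : X d => ℝ) ∞} (hh : ∀ q t : X d, h (q + (s : ℤ) • t) = h q) : E (R h) = h :=
  lp.ext (funext fun q => by rw [hE, hR, apply_windowMap_siteOf hh])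

/-- **`‖R h‖_∞ = ‖h‖_∞` ON PERIODIC FIELDS.** [folklore] -/
theorem norm_restrict_of_periodic (hE : ∀ (g : Site d s → ℝ) (q : X d), E g q = g (siteOf d s q))
    (hR : ∀ (h : lp (fun _ : X d => ℝ) ∞) (x : Site d s), R h x = h (windowMap d s x))
    {h : lp (fun _ : X d => ℝ) ∞} (hh : ∀ q t : X d, h (q + (s : ℤ) • t) = h q) : ‖R h‖ = ‖h‖ := by
  conv_rhs => rw [← periodise_restrict_of_periodic hE hR hh]
  exact (norm_periodise hE (R h)).symm

/-- Periodisation is injective. [folklore] -/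
theorem periodise_injective (hE : ∀ (g : Site d s → ℝ) (q : X d), E g q = g (siteOf d s q))
    (hR : ∀ (h : lp (fun _ : X d => ℝ) ∞) (x : Site d s), R h x = h (windowMap d s x)) :
    Function.Injective E := fun g g' hgg' => by
  rw [← restrict_periodise hE hR g, ← restrict_periodise hE hR g', hgg']

/-- Two periodic fields with the same window restriction are equal. [folklore] -/
theorem eq_of_restrict_eq_of_periodic (hE : ∀ (g : Site d s → ℝ) (q : X d), E g q = g (siteOf d s q))
    (hR : ∀ (h : lp (fun _ : X d => ℝ) ∞) (x : Site d s), R h x = h (windowMap d s x))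
    {h h' : lp (fun _ : X d => ℝ) ∞} (hh : ∀ q t : X d, h (q + (s : ℤ) • t) = h q)
    (hh' : ∀ q t : X d, h' (q + (s : ℤ) • t) = h' q) (hRR : R h = R h') : h = h' := by
  rw [← periodise_restrict_of_periodic hE hR hh, ← periodise_restrict_of_periodic hE hR hh', hRR]

end Laws

/-- **THE TORUS SUP CARRIER OF THE PERIODIC SUBSPACE** (assembled): periodisation `E` and window restriction `R` (`‖R‖ ≤ 1`) with
`‖E g‖ = ‖g‖`, `R (E g) = g`, `E g` periodic, and `E (R h) = h`, `‖R h‖ = ‖h‖` on `s`-periodic `h`. [folklore] -/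
theorem exists_torus_carrier (s : ℕ) [NeZero s] :
    ∃ (E : (Site d s → ℝ) →L[ℝ] lp (fun _ : X d => ℝ) ∞) (R : lp (fun _ : X d => ℝ) ∞ →L[ℝ] (Site d s → ℝ)),
      (∀ (g : Site d s → ℝ) (q : X d), E g q = g (siteOf d s q)) ∧
      (∀ (h : lp (fun _ : X d => ℝ) ∞) (x : Site d s), R h x = h (windowMap d s x)) ∧
      (∀ g, ‖E g‖ = ‖g‖) ∧ ‖R‖ ≤ 1 ∧ (∀ g, R (E g) = g) ∧
      (∀ (g : Site d s → ℝ) (q t : X d), E g (q + (s : ℤ) • t) = E g q) ∧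
      ∀ h : lp (fun _ : X d => ℝ) ∞, (∀ q t : X d, h (q + (s : ℤ) • t) = h q) → E (R h) = h ∧ ‖R h‖ = ‖h‖ := by
  obtain ⟨E, hE⟩ := exists_clm_periodise (d := d) s
  obtain ⟨R, hR, hR1⟩ := exists_clm_restrict (d := d) s
  exact ⟨E, R, hE, hR, norm_periodise hE, hR1, restrict_periodise hE hR, periodise_periodic hE,
    fun h hh => ⟨periodise_restrict_of_periodic hE hR hh, norm_restrict_of_periodic hE hR hh⟩⟩

/-! ## §3. Transfer: a periodic-to-periodic chart of `ℓ^∞` IS a chart between torus carriers, same constant -/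

/-- **FORWARD: THE CHART OF A TORUS FIELD HAS TORUS COORDINATES** — if `Dop` ∕ `Rop` send `N`-periodic fields to `s`- ∕ `N`-periodic
ones, `(Dop (Ef ht), Rop (Ef ht))` is the periodisation of `(Rc (Dop (Ef ht)), Rf (Rop (Ef ht)))`, the second in the fibre. [folklore] -/
theorem torus_coords_of_periodic {N s : ℕ} [NeZero N] [NeZero s]
    {Dop : lp (fun _ : X d => ℝ) ∞ →L[ℝ] lp (fun _ : X d => ℝ) ∞}
    {Rop : lp (fun _ : X d => ℝ) ∞ →L[ℝ] Dop.ker}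
    (hper : ∀ h : lp (fun _ : X d => ℝ) ∞, (∀ q t : X d, h (q + (N : ℤ) • t) = h q) →
      (∀ y t : X d, Dop h (y + (s : ℤ) • t) = Dop h y) ∧
      (∀ q t : X d, (Rop h : lp (fun _ : X d => ℝ) ∞) (q + (N : ℤ) • t) = (Rop h : lp (fun _ : X d => ℝ) ∞) q))
    {Ef : (Site d N → ℝ) →L[ℝ] lp (fun _ : X d => ℝ) ∞} {Rf : lp (fun _ : X d => ℝ) ∞ →L[ℝ] (Site d N → ℝ)}
    {Ec : (Site d s → ℝ) →L[ℝ] lp (fun _ : X d => ℝ) ∞} {Rc : lp (fun _ : X d => ℝ) ∞ →L[ℝ] (Site d s → ℝ)}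
    (hEf : ∀ (g : Site d N → ℝ) (q : X d), Ef g q = g (siteOf d N q))
    (hRf : ∀ (h : lp (fun _ : X d => ℝ) ∞) (x : Site d N), Rf h x = h (windowMap d N x))
    (hEc : ∀ (g : Site d s → ℝ) (q : X d), Ec g q = g (siteOf d s q))
    (hRc : ∀ (h : lp (fun _ : X d => ℝ) ∞) (x : Site d s), Rc h x = h (windowMap d s x))
    (ht : Site d N → ℝ) :
    Dop (Ef ht) = Ec (Rc (Dop (Ef ht))) ∧
      (Rop (Ef ht) : lp (fun _ : X d => ℝ) ∞) = Ef (Rf (Rop (Ef ht) : lp (fun _ : X d => ℝ) ∞)) ∧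
      Dop (Ef (Rf (Rop (Ef ht) : lp (fun _ : X d => ℝ) ∞))) = 0 := by
  obtain ⟨h1, h2⟩ := hper (Ef ht) (periodise_periodic hEf ht)
  have e2 : Ef (Rf (Rop (Ef ht) : lp (fun _ : X d => ℝ) ∞)) = (Rop (Ef ht) : lp (fun _ : X d => ℝ) ∞) :=
    periodise_restrict_of_periodic hEf hRf h2
  refine ⟨(periodise_restrict_of_periodic hEc hRc h1).symm, e2.symm, ?_⟩
  rw [e2]
  exact (LinearMap.mem_ker).1 (Rop (Ef ht)).2

/-- **INVERSE: A CHART OF `ℓ^∞(ℤ^d)` WHOSE INVERSE PRESERVES PERIODICITY IS A BIJECTION ONTO THE TORUS DATA, SAME CONSTANT** — for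
`T h = (Dop h, Rop h)`, `‖T⁻¹ y‖ ≤ C‖y‖`, `T⁻¹` of (`s`-periodic, `N`-periodic) data `N`-periodic: every torus datum `(wt, κt)` with
`Dop (Ef κt) = 0` has EXACTLY ONE torus field `ht` with `Dop (Ef ht) = Ec wt`, `Rop (Ef ht) = Ef κt`; `‖ht‖ ≤ C·max ‖wt‖ ‖κt‖`. [folklore] -/
theorem torus_chart_of_periodic {N s : ℕ} [NeZero N] [NeZero s]
    {Dop : lp (fun _ : X d => ℝ) ∞ →L[ℝ] lp (fun _ : X d => ℝ) ∞}
    {Rop : lp (fun _ : X d => ℝ) ∞ →L[ℝ] Dop.ker}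
    (T : lp (fun _ : X d => ℝ) ∞ ≃L[ℝ] (lp (fun _ : X d => ℝ) ∞) × Dop.ker)
    (hT : ∀ h, T h = (Dop h, Rop h)) {C : ℝ} (hTi : ∀ y, ‖T.symm y‖ ≤ C * ‖y‖)
    (hinv : ∀ (w : lp (fun _ : X d => ℝ) ∞) (κ : Dop.ker), (∀ y t : X d, w (y + (s : ℤ) • t) = w y) →
      (∀ q t : X d, (κ : lp (fun _ : X d => ℝ) ∞) (q + (N : ℤ) • t) = (κ : lp (fun _ : X d => ℝ) ∞) q) →
      ∀ q t : X d, (T.symm (w, κ) : lp (fun _ : X d => ℝ) ∞) (q + (N : ℤ) • t)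
        = (T.symm (w, κ) : lp (fun _ : X d => ℝ) ∞) q)
    {Ef : (Site d N → ℝ) →L[ℝ] lp (fun _ : X d => ℝ) ∞} {Rf : lp (fun _ : X d => ℝ) ∞ →L[ℝ] (Site d N → ℝ)}
    {Ec : (Site d s → ℝ) →L[ℝ] lp (fun _ : X d => ℝ) ∞}
    (hEf : ∀ (g : Site d N → ℝ) (q : X d), Ef g q = g (siteOf d N q))
    (hRf : ∀ (h : lp (fun _ : X d => ℝ) ∞) (x : Site d N), Rf h x = h (windowMap d N x))
    (hEc : ∀ (g : Site d s → ℝ) (q : X d), Ec g q = g (siteOf d s q))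
    (wt : Site d s → ℝ) (κt : Site d N → ℝ) (hκt : Dop (Ef κt) = 0) :
    ∃ ht : Site d N → ℝ,
      (Dop (Ef ht) = Ec wt ∧ (Rop (Ef ht) : lp (fun _ : X d => ℝ) ∞) = Ef κt) ∧
      ‖ht‖ ≤ C * max ‖wt‖ ‖κt‖ ∧
      ∀ ht' : Site d N → ℝ, Dop (Ef ht') = Ec wt →
        (Rop (Ef ht') : lp (fun _ : X d => ℝ) ∞) = Ef κt → ht' = ht := by
  -- the fibre datum as an element of `ker Dop`, the preimage `h := T⁻¹ (Ec wt, κ)` and its window restriction `ht := Rf h`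
  set κ : Dop.ker := ⟨Ef κt, (LinearMap.mem_ker).2 hκt⟩ with hκdef
  have hκcoe : (κ : lp (fun _ : X d => ℝ) ∞) = Ef κt := rfl
  set h : lp (fun _ : X d => ℝ) ∞ := T.symm (Ec wt, κ) with hhdef
  have hh : ∀ q t : X d, h (q + (N : ℤ) • t) = h q :=
    hinv (Ec wt) κ (periodise_periodic hEc wt) (by rw [hκcoe]; exact periodise_periodic hEf κt)
  have hTh : T h = (Ec wt, κ) := by rw [hhdef, ContinuousLinearEquiv.apply_symm_apply]
  rw [hT, Prod.mk.injEq] at hTh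
  obtain ⟨hDh, hRh⟩ := hTh
  have hEfRf : Ef (Rf h) = h := periodise_restrict_of_periodic hEf hRf hh
  refine ⟨Rf h, ⟨by rw [hEfRf, hDh], by rw [hEfRf, hRh]⟩, ?_, ?_⟩
  · -- the bound: `‖Rf h‖ = ‖h‖ ≤ C‖(Ec wt, κ)‖ = C·max ‖wt‖ ‖κt‖`
    rw [norm_restrict_of_periodic hEf hRf hh, hhdef]
    refine (hTi _).trans (le_of_eq ?_)
    rw [Prod.norm_def, norm_periodise hEc, ← Submodule.norm_coe, hκcoe, norm_periodise hEf]
  · -- uniqueness: `T (Ef ht') = (Ec wt, κ) = T h`, so `Ef ht' = h = Ef (Rf h)` and `Ef` is injective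
    intro ht' hD' hR'
    have hκ' : Rop (Ef ht') = κ := Subtype.ext (by rw [hR', hκcoe])
    have hT' : T (Ef ht') = T h := by rw [hT, hT, hD', hκ', hDh, hRh]
    have hEq : Ef ht' = h := T.injective hT'
    exact periodise_injective hEf hRf (by rw [hEq, hEfRf])

/-! ## §4. Instance: (72)'s augmented sup chart as a chart between the torus carriers `Site d ((n+1)s)` and `Site d s` -/

/-- The fine period `(n+1)·s` as the skeleton's `side n • (s • t)`. [folklore] -/
theorem natCast_mul_smul_eq (n s : ℕ) (t : X d) : (((n + 1) * s : ℕ) : ℤ) • t = side n • ((s : ℤ) • t) := by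
  rw [smul_smul, show side n * (s : ℤ) = (((n + 1) * s : ℕ) : ℤ) by simp only [side, Nat.cast_mul, Nat.cast_add, Nat.cast_one]]

/-- **THE AUGMENTED SUP CHART OF THE GAUSSIAN SKELETON IS A CHART BETWEEN TORUS CARRIERS, SAME CONSTANT** (`d ≥ 3`, every side
`n + 1`, `a > 0`, every coarse period `s ≥ 1`): (72)'s `Dop = Q′`, `Aop = A`, `Pop = P` (actions displayed, `‖Q′‖ ≤ 1`, `‖P‖ ≤ 2`),
`Rop = P∘A` into `ker Q′`, the SAME chart witness `T h = (Q′h, P(Ah))` with its displayed inverse `T⁻¹(w,κ) = Hw + Γκ` and bound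
`‖T⁻¹y‖ ≤ N_∞‖y‖` re-exported (chair leaf-04 g163's G-1), together with carrier maps `Ef ∕ Rf` of the fine torus `Site d ((n+1)·s)` and `Ec ∕ Rc` of the coarse torus `Site d s`
(actions displayed, `‖Ef g‖ = ‖g‖`, `Rf (Ef g) = g`, `‖Ec g‖ = ‖g‖`, `Rc (Ec g) = g`), such that (FORWARD) every fine torus field
`ht` has torus chart coordinates — `Q′(Ef ht) = Ec (Rc (Q′(Ef ht)))`, `P(A(Ef ht)) = Ef (Rf (P(A(Ef ht))))`, the latter in the fibre —
and (INVERSE) for every coarse torus field `wt` and every fine torus fibre datum `κt` (`Q′(Ef κt) = 0`) there is EXACTLY ONE fine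
torus field `ht` with `Q′(Ef ht) = Ec wt`, `P(A(Ef ht)) = Ef κt`, and
`‖ht‖_∞ ≤ (C_∞ + A_G·K_d(δ_u∕4)·(1 + C_∞))·max ‖wt‖_∞ ‖κt‖_∞` — (72) `exists_aug_equiv_sup_periodic` + §3. [folklore] -/
theorem exists_aug_chart_torus (hd : 3 ≤ d) (n : ℕ) {a : ℝ} (ha : 0 < a) (s : ℕ) [NeZero s] :
    ∃ (Dop Aop Pop : lp (fun _ : X d => ℝ) ∞ →L[ℝ] lp (fun _ : X d => ℝ) ∞)
      (Rop : lp (fun _ : X d => ℝ) ∞ →L[ℝ] Dop.ker)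
      (T : lp (fun _ : X d => ℝ) ∞ ≃L[ℝ] (lp (fun _ : X d => ℝ) ∞) × Dop.ker)
      (Ef : (Site d ((n + 1) * s) → ℝ) →L[ℝ] lp (fun _ : X d => ℝ) ∞)
      (Rf : lp (fun _ : X d => ℝ) ∞ →L[ℝ] (Site d ((n + 1) * s) → ℝ))
      (Ec : (Site d s → ℝ) →L[ℝ] lp (fun _ : X d => ℝ) ∞)
      (Rc : lp (fun _ : X d => ℝ) ∞ →L[ℝ] (Site d s → ℝ)),
      (∀ (f : lp (fun _ : X d => ℝ) ∞) (y : X d), Dop f y = (((n : ℝ) + 1) ^ d)⁻¹ * ∑ p ∈ B n y, f p) ∧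
      (∀ (f : lp (fun _ : X d => ℝ) ∞) (p : X d), Aop f p = ∑ r ∈ nbhd n p, AX n a p r * f r) ∧
      (∀ (f : lp (fun _ : X d => ℝ) ∞) (p : X d), Pop f p = f p - (((n : ℝ) + 1) ^ d)⁻¹ * ∑ p' ∈ B n (blk n p), f p') ∧
      ‖Dop‖ ≤ 1 ∧ ‖Pop‖ ≤ 2 ∧ (∀ h, (Rop h : lp (fun _ : X d => ℝ) ∞) = Pop (Aop h)) ∧
      (∀ h, T h = (Dop h, Rop h)) ∧
      (∀ (w : lp (fun _ : X d => ℝ) ∞) (κ : Dop.ker) (p : X d),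
        (T.symm (w, κ) : lp (fun _ : X d => ℝ) ∞) p
          = HBZd n a w p
            + ((∑' q : X d, Gk n a p q * (κ : lp (fun _ : X d => ℝ) ∞) q)
              - HBZd n a (fun y => (((n : ℝ) + 1) ^ d)⁻¹ * ∑ p' ∈ B n y,
                  ∑' q : X d, Gk n a p' q * (κ : lp (fun _ : X d => ℝ) ∞) q) p)) ∧
      (∀ y, ‖T.symm y‖
        ≤ (cHs d a * latticeConst d (deltaH d a)
            + ((cG0 d * cKL d (d - 2) + cSplit d a) * Real.exp (2 * deltaU d a)
                + cFar d a * Real.exp (4 * deltaU d a) / deltaU d a ^ 2) * latticeConst d (deltaU d a / 4)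
              * (1 + cHs d a * latticeConst d (deltaH d a))) * ‖y‖) ∧
      (∀ (g : Site d ((n + 1) * s) → ℝ) (q : X d), Ef g q = g (siteOf d ((n + 1) * s) q)) ∧
      (∀ (h : lp (fun _ : X d => ℝ) ∞) (x : Site d ((n + 1) * s)), Rf h x = h (windowMap d ((n + 1) * s) x)) ∧
      (∀ (g : Site d s → ℝ) (q : X d), Ec g q = g (siteOf d s q)) ∧
      (∀ (h : lp (fun _ : X d => ℝ) ∞) (x : Site d s), Rc h x = h (windowMap d s x)) ∧
      (∀ g, ‖Ef g‖ = ‖g‖) ∧ (∀ g, Rf (Ef g) = g) ∧ (∀ g, ‖Ec g‖ = ‖g‖) ∧ (∀ g, Rc (Ec g) = g) ∧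
      (∀ ht : Site d ((n + 1) * s) → ℝ,
        Dop (Ef ht) = Ec (Rc (Dop (Ef ht))) ∧
        (Rop (Ef ht) : lp (fun _ : X d => ℝ) ∞) = Ef (Rf (Rop (Ef ht) : lp (fun _ : X d => ℝ) ∞)) ∧
        Dop (Ef (Rf (Rop (Ef ht) : lp (fun _ : X d => ℝ) ∞))) = 0) ∧
      ∀ (wt : Site d s → ℝ) (κt : Site d ((n + 1) * s) → ℝ), Dop (Ef κt) = 0 →
        ∃ ht : Site d ((n + 1) * s) → ℝ,
          (Dop (Ef ht) = Ec wt ∧ (Rop (Ef ht) : lp (fun _ : X d => ℝ) ∞) = Ef κt) ∧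
          ‖ht‖ ≤ (cHs d a * latticeConst d (deltaH d a)
                + ((cG0 d * cKL d (d - 2) + cSplit d a) * Real.exp (2 * deltaU d a)
                    + cFar d a * Real.exp (4 * deltaU d a) / deltaU d a ^ 2) * latticeConst d (deltaU d a / 4)
                  * (1 + cHs d a * latticeConst d (deltaH d a))) * max ‖wt‖ ‖κt‖ ∧
          ∀ ht' : Site d ((n + 1) * s) → ℝ, Dop (Ef ht') = Ec wt →
            (Rop (Ef ht') : lp (fun _ : X d => ℝ) ∞) = Ef κt → ht' = ht := by
  obtain ⟨Dop, Aop, Pop, hD, hA, hP, hD1, hP2, Rop, hRop, T, hT, hTsymm, hTi, hperT⟩ :=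
    exists_aug_equiv_sup_periodic hd n ha
  obtain ⟨Ef, hEf⟩ := exists_clm_periodise (d := d) ((n + 1) * s)
  obtain ⟨Rf, hRf, -⟩ := exists_clm_restrict (d := d) ((n + 1) * s)
  obtain ⟨Ec, hEc⟩ := exists_clm_periodise (d := d) s
  obtain ⟨Rc, hRc, -⟩ := exists_clm_restrict (d := d) s
  -- (72)'s periodicity clauses at coarse period `s`, rewritten to the fine period `(n+1)·s`
  obtain ⟨hper, hinv⟩ := hperT s
  have hper' : ∀ h : lp (fun _ : X d => ℝ) ∞, (∀ q t : X d, h (q + (((n + 1) * s : ℕ) : ℤ) • t) = h q) →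
      (∀ y t : X d, Dop h (y + (s : ℤ) • t) = Dop h y) ∧
      (∀ q t : X d, (Rop h : lp (fun _ : X d => ℝ) ∞) (q + (((n + 1) * s : ℕ) : ℤ) • t)
        = (Rop h : lp (fun _ : X d => ℝ) ∞) q) := fun h hh => by
    have hh' : ∀ q t : X d, h (q + side n • ((s : ℤ) • t)) = h q := fun q t => by
      rw [← natCast_mul_smul_eq]; exact hh q t
    obtain ⟨h1, h2⟩ := hper h hh'
    exact ⟨h1, fun q t => by rw [natCast_mul_smul_eq]; exact h2 q t⟩
  have hinv' : ∀ (w : lp (fun _ : X d => ℝ) ∞) (κ : Dop.ker), (∀ y t : X d, w (y + (s : ℤ) • t) = w y) →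
      (∀ q t : X d, (κ : lp (fun _ : X d => ℝ) ∞) (q + (((n + 1) * s : ℕ) : ℤ) • t) = (κ : lp (fun _ : X d => ℝ) ∞) q) →
      ∀ q t : X d, (T.symm (w, κ) : lp (fun _ : X d => ℝ) ∞) (q + (((n + 1) * s : ℕ) : ℤ) • t)
        = (T.symm (w, κ) : lp (fun _ : X d => ℝ) ∞) q := fun w κ hw hκ q t => by
    have hκ' : ∀ q t : X d, (κ : lp (fun _ : X d => ℝ) ∞) (q + side n • ((s : ℤ) • t))
        = (κ : lp (fun _ : X d => ℝ) ∞) q := fun q t => by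
      rw [← natCast_mul_smul_eq]; exact hκ q t
    rw [natCast_mul_smul_eq]
    exact hinv w κ hw hκ' q t
  exact ⟨Dop, Aop, Pop, Rop, T, Ef, Rf, Ec, Rc, hD, hA, hP, hD1, hP2, hRop, hT, hTsymm, hTi, hEf, hRf, hEc, hRc, norm_periodise hEf,
    restrict_periodise hEf hRf, norm_periodise hEc, restrict_periodise hEc hRc,
    torus_coords_of_periodic hper' hEf hRf hEc hRc,
    fun wt κt hκt => torus_chart_of_periodic T hT hTi hinv' hEf hRf hEc wt κt hκt⟩

/-! ## §5. Toy -/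

/-- Toy (`s = 1`): a field factors through the one-point torus iff it is `1`-periodic (`periodic_iff_exists_comp_siteOf`). [folklore] -/
example (h : X d → ℝ) : (∀ q t : X d, h (q + ((1 : ℕ) : ℤ) • t) = h q) ↔ ∃ g : Site d 1 → ℝ, ∀ q, h q = g (siteOf d 1 q) :=
  periodic_iff_exists_comp_siteOf h

end Summit.QuantumFields.BalabanUV.T4Continuum.NE7b.PeriodicSupTorusCarrier

end
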